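import Summits.Ventures.YMGap.Thresholds.TwistedBochnerEveryN
import Summits.Ventures.YMGap.Thresholds.TwistedBochnerSU3Trace
import Summits.Ventures.YMGap.RobustBall.KernelSusceptibility
import Summits.Ventures.YMGap.RobustBall.AreaLawRowsSU3PV2Tr
import Summits.Ventures.YMGap.RobustBall.StringTensionOnBallSU3PV2Tr
import Summits.Ventures.YMGap.Thresholds.StrongCouplingAllGroupsSharp
import Summits.Ventures.YMGap.RobustBall.BoundaryFreeEnergyDim
import HarnessLib

/-!
# Venture statement — YMGap (cell `pub-ymgap`) — CONJUNCT BODIES T87 (= T87a–d), T88, T89 (= T89a,b), T90, T91 (V23I, block 1)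

STATUS: FILED by p3 g12 as V23I = T87 (= T87a–d) + T88 + T89 (= T89a,b) + T90 + T91 on the chair's ★ R377 (A) (lead g13, bus 2026-08-25T05:42:23Z, INBOX l.7754), quoted:
«R377 (A) V23I BOOKING = YES, same shape as V23E–V23H (R322∕R324∕R347∕R349∕R362∕R368 (C)∕R372): composition T87 `T87_TwistedOneLinkPoincareEveryN` (a–d; engine-2 texts
5a63486b19fd6498, CONFIRMED l.7749 …) + T88 `T88_SU2WilsonKernelEnergyVariance` (ds-3 g14 part E e22e68fa09be3eb4; window to 06:40Z, silence = consent) + T89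
`T89_SU3BallAreaLawAndStringTensionPV2Tr` (a, b; engine-2 fad7f67898b66390, CONFIRMED); may grow before the FINAL-sha line, frozen at it; referee g37 pre-audits the
candidate …, diffs the FINAL (header-only expected) + mono; ONE dry-run → ONE `--review` filing ≥ 15 min after the V23H filing (R313) → ONE wait∕poll per session»; growth
T90 (bus l.7766) and T91 (l.7787) announced before this line under «may grow», READ ✓ by the chair (l.7776, l.7793). Owner words: engine-2 g15 CONFIRM l.7749 (T87, T89);
ds-3 (g17; T88, T91) and ds-1 (g15; T90): no correction by the 06:40Z window (silence = consent per R377 (A)). Referee g37 pre-audit: F-732 (candidate 01d6578efb710bb2,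
T87–T90) + referee g38 F-740 (candidate 5e96dd448d8daec5, T87–T91: CLEAN TO FILE; advisory: the empty `section U1` of the ds-1 section kept verbatim); the re-diff of THIS
final is asked on the bus before the filing. Composition frozen = T87 + T88 + T89 + T90 + T91; this FINAL differs from the candidate 5e96dd448d8daec5 in this STATUS
sentence only (decl lines identical). Numbers T87, T88, T89, T90, T91 assigned by p3 under lead g10's delegation (bus 2026-08-24T09:03:51Z «T-numbers (T71+) are p3's to
assign»; ★ R322 (4) / ★ R324 (4); lead g13 R362 / R368 (C) / R372: «a set GREEN after the V23H final-sha line goes to the next block») in GREEN order (the time a set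
first answers a by-import `lean check` rc 0 / 0 warnings / std axioms with all parents TREE modules with built oleans; ties inside one olean batch broken by the order of
the owners' READY lines), announced on the bus before filing: T87 — engine-2 g12/g15 every-`N` texts `HOME/pub-ymgap-engine-2/lean/T-texts-engine2-EveryN.lean`
5a63486b19fd6498 (owner pointer bus l.7479, GREEN 03:13Z 2026-08-25; parents `Thresholds/TwistedBochnerEveryN` p384646 de05ca6443bd (tree b76dd26209d6, olean 01:42Z),
`Thresholds/TwistedBochnerSU3Trace` p390646 1c19ccea0872 (1785dc52ed9b, 03:00Z)) rc 0 re-checked 05:3xZ; T88 — ds-3 g14 part E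
`HOME/ds/ds3/lean/g14/texts/V1XConjunctsDS3g14E.lean` e22e68fa09be3eb4 (owner texts announced with K1, bus l.5842 2026-08-24; parent `RobustBall/KernelSusceptibility`
p392708 88b1d430ba2c (19138c8a3716, olean 05:29Z 2026-08-25)) rc 0 at 05:3xZ; T89 — engine-2 g15 PV2Tr texts `HOME/pub-ymgap-engine-2/lean/T-texts-engine2-PV2Tr.lean`
fad7f67898b66390 (owner pointers bus l.7623 / l.7729 «NOW FILEABLE BY YOU», owner by-import rc 0 05:33Z; parents `RobustBall/AreaLawRowsSU3PV2Tr` p391862 2e3134f2f892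
(000717d85738, olean 04:23Z), `RobustBall/StringTensionOnBallSU3PV2Tr` p392280 6f0bb7d4ca31 (3b5f472b7473, 05:28Z)) rc 0 at 05:3xZ; T90 — ds-1 g14 block B
`HOME/ds/ds1g14/lean/V1X-CONJUNCTS-ds1g14-B.lean` 1dbc3b83fcfcfda9 (owner texts for p3, 2026-08-24; parent `Thresholds/StrongCouplingAllGroupsSharp` p387021 2d0c226ac4fe
(71f0bdaf86a0, olean 02:24Z 2026-08-25)) rc 0 at 05:46Z — GROWTH announced after T87–T89, hence T90; of its two texts ONLY the closed one
`T90_UnitaryStrongCouplingCornerSharp` is taken: the U(1)/ℤ_n text `T_U1ZnFourStrongCouplingUniqueness` sits under `variable [MeasurableSpace Circle] [BorelSpace Circle]`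
and is therefore not a closed `Prop` (p3 g11's heads-up bus l.7255, option (b); owner silent since) — it and the owner's block witness `v1x_ds1g14B_block_holds` are
EDITORIAL DROPS via the map (`X -`; the V23G precedent), deferred until the owner restates the text closed; the now-empty `section U1` with its `variable` line stays
verbatim; T91 — ds-3 g17 part E `HOME/ds/ds3/lean/g17/texts/V1XConjunctsDS3g17E.lean` 0eca03929cff5b53 (owner text file «TEXT for the p2/p3 seats» in the g17 texts
directory since 01:30Z 2026-08-25, no separate READY line — owner CONFIRM asked in the growth line; parent `RobustBall/BoundaryFreeEnergyDim` p388898 (7e5438f72c5a, olean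
01:39Z 2026-08-25)) rc 0 at 05:54Z — GROWTH announced after T90, hence T91. Only decl names change (map `RENAMES-V23I.txt`: `T_X ↦ T87x_X` / `T88_X` / `T89x_X` / `T90_X`
/ `T91_X` with p3's consolidating conjunctions `T87_TwistedOneLinkPoincareEveryN`, `T89_SU3BallAreaLawAndStringTensionPV2Tr` in the V20B/V22/V23D style — additions, not
owner bytes; T88, T90 and T91 are single texts and carry their numbers directly); ds-3's part-E files (g14 E, g17 E) declare at the root with `open Summit.Ventures.YMGap
…` lines (kept) and land inside `namespace Summit.Ventures.YMGap` like every block decl; built mechanically by `mkmono23i.py` (= p2 g11's `mkmono.py`); byte-compare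
`bytecmp.py --map` = verbatim-modulo-map (3 decls dropped per map in the ds-1 section). NOT IN THIS BLOCK: the T91+ queue of INDEX-0823 (ds-1 g14 (StrongCouplingAllGroups
olean) and the U(1)/ℤ_n cells, ds-3 g17 B–D, rb-p2 g10 / g12, rb-p1 g8 / g9 / g11, and the sets whose parents are not yet tree files).

HONEST FRAMING. WHAT THIS IS: bodies `Tk_… : Prop` + witnesses `Tk_…_holds`, kernel-checked with NO hypothesis, closing by TREE constants only. STRONG-COUPLING
LATTICE statements. (T87) ONE-LINK FUNCTIONAL INEQUALITIES: for EVERY `SU(N)`, `N ≥ 2`, the twisted one-link Poincaré constant `OneLinkPoincareSUN N R (1/K)` on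
the explicit quadratic region in `(K, R)`, strictly better than Bakry–Émery's `1/(N(1/2 − R))` and alive at and beyond the Bakry–Émery cap `R = 1/2`; the `SU(4)`
rows; the `SU(3)` trace-norm constant on `K + (64/35)R ≤ 12/7` — statements about ONE tilted Haar law on `SU(N)` (the one-link conditional law at small `β`);
the gain over Bakry–Émery is `O(1/N²)`, NO `N`-uniform improvement, radii are where a bound closes. (T88) `SU(2)` `ℤ⁴` Wilson kernels at `0 ≤ β_W ≤ 1/12`: the
finite-volume energy variance of any plaquette set is `≤ χ · #P` uniformly in the volume, the boundary field and the region — a variance-density ceiling inside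
the single-link door («specific heat» = variance density; no thermodynamic-limit or critical statement). (T89) `SU(3)` on ONE tier-1 ball `(7/500, 7/1000)`: the
area-law segments `0 ≤ β_W ≤ 3/5` (`d = 4`) and `0 ≤ β_W ≤ 9/10` (`d = 3`) and the `d = 4` string-tension reading (`HasAreaLawWith μ χ₃ C c`, `c > 0`, and `c ≤ σ(μ)`
whenever the string tension exists) for every limit state of every eventually-slab-local family in the ball — thresholds, radii and loads are door artefacts,
`σ`-existence for non-Wilson members is NOT claimed. (T90) ONE-STATE-G, sharp count: for every continuous UNITARY representation `ρ : G → U(N)` of a compact metrisable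
second-countable group, every `d` and every `6(d−1)N|β| < 1`: EXACTLY ONE DLR state of the Wilson action, translation invariant, and the FULL sequence of torus Wilson
states converges to it on bounded continuous observables — DLR uniqueness on the total-variation Dobrushin corner (`SU(2)`, `d = 4`: `|β| < 1/36` ≪ the tree's `9/50`), a
door artefact; the `U(1)`/`ℤ_n` cells are NOT in this block. (T91) `SU(N)` Wilson, EVERY `N ≥ 2`, EVERY `d ≥ 2`, 't Hooft `0 ≤ β ≤ 1/(12(d−1))`,
`β < 1/(8d)`: BOUNDARY-UNIFORM FREE-ENERGY ADDITIVITY — for every finite link volume with ANY frozen boundary field, `|log Z_Λ(Nβ|η) − (#T(Λ)/#planes)·f(Nβ)|` is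
bounded by `Nβ·Σ_p min(2N, 32N⁴√N·max(ρ,½)^{⌊D_p⌋})` in the plaquette depths `D_p` (ratio hypothesis non-vacuous exactly on `β < 1/(16(d−1))`) — the DS Condition-I
SHAPE of the free energy with door constants, one-sided in `β`, NOT the Dobrushin–Shlosman mixing condition itself and nothing at the Y3 couplings. Nothing here is about `β → ∞`, the crossover couplings, a continuum limit, a physical-units mass gap or
the Yang–Mills Millennium problem.
-/

noncomputable section

namespace Summit.Ventures.YMGap

/-! ### OWNER FILE `owners/T-texts-engine2-EveryN.lean` (sha16 5a63486b19fd6498) — section `V23I_engine2_EveryN` -/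
section V23I_engine2_EveryN

/-!
# Venture statement — YMGap (cell `pub-ymgap`) — OWNER TEXT «engine-2 g12: the twisted one-link Poincaré constant for EVERY SU(N), and the SU(3)
# trace-norm constant» for the lead's V24 list; engine-2 g12.  STAGED — file only after the parents `TwistedBochnerEveryN` / `TwistedBochnerSU3Trace` land.

HONEST FRAMING. WHAT THIS IS: kernel-checked strong-coupling LATTICE statements, HYPOTHESIS-FREE («no displayed one-link hypothesis»), about ONE
tilted Haar law `ν_B(dg) ∝ exp(N Re tr(gB)) dg` on `SU(N)` (the one-link conditional law of lattice Yang–Mills at small `β`): (i) for EVERY `N ≥ 2` the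
twisted one-link Poincaré constant `OneLinkPoincareSUN N R (1/K)` whenever `0 < K`, `K + ((N²−1)/N)R + ((N²−1)/(2N(N²−2)))R² ≤ N(N²−1)/(2(N²−2))`
(`TwistedBochnerIntegrated.oneLinkPoincareSUN_twisted`: g11's pointwise twisted Bochner inequality integrated with twist `θ = 1/N²`, no Hessian split),
STRICTLY better than Bakry–Émery's `1/(N(1/2 − R))` at every `N`, `0 ≤ R ≤ 1/2`, and alive at and beyond the Bakry–Émery cap: `OneLinkPoincareSUN N (1/2) (8N/7)`,
`OneLinkPoincareSUN N (1/2 + 1/(2N²)) (8N/3)` (`TwistedBochnerEveryN`); (ii) the `SU(4)` rows `(3/10, 1)`, `(2/5, 50/31)`, `(1/2, 64/15)`; (iii) for `SU(3)`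
the TRACE-NORM twisted constant `OneLinkPoincareSUN 3 R (1/K)` whenever `0 < K`, `K + (64/35)R ≤ 12/7` (`TwistedBochnerSU3Trace.oneLinkPoincareSUN_su3_twisted_tr`;
supersedes T71a's `(97/50)R` in reach, not in kind).  HONEST LABEL: explicit strong-coupling constants; NO `N`-uniform gain (the improvement over
Bakry–Émery is `O(1/N²)`; the every-`N` 't Hooft rows do not move); radii are where a bound closes, not physical transitions.
NOT CLAIMED: anything for SU(2) beyond J-SC13; the CERTIFIED (H1 ∧ H2) SU(3) column; sharpness; anything about the crossover, the continuum, or the Clay problem.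
-/



section Engine2EveryNsec

open Summit.QuantumFields.BalabanUV.InfraRed.StrongCouplingPoincareDoorSUN (OneLinkPoincareSUN)
open Summit.Ventures.YMGap.TwistedBochner

/-- **T87a_SUNTwistedPoincare — EVERY `SU(N)`, `N ≥ 2`, HYPOTHESIS-FREE**: the twisted one-link Poincaré constant: for every `0 < K` and `R` with
`K + ((N²−1)/N)R + ((N²−1)/(2N(N²−2)))R² ≤ N(N²−1)/(2(N²−2))`, `OneLinkPoincareSUN N R (1/K)` (`TwistedBochner.oneLinkPoincareSUN_twisted`;
Bakry–Émery: `1/(N(1/2 − R))`, `R < 1/2`). -/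
def T87a_SUNTwistedPoincare : Prop :=
  ∀ N : ℕ, 2 ≤ N → ∀ R K : ℝ, 0 < K →
    K + ((N : ℝ) ^ 2 - 1) / N * R + ((N : ℝ) ^ 2 - 1) / (2 * N * ((N : ℝ) ^ 2 - 2)) * R ^ 2 ≤ (N : ℝ) * ((N : ℝ) ^ 2 - 1) / (2 * ((N : ℝ) ^ 2 - 2)) →
    OneLinkPoincareSUN N R (1 / K)

/-- T87a_SUNTwistedPoincare holds. -/
theorem T87a_SUNTwistedPoincare_holds : T87a_SUNTwistedPoincare := fun _ hN _ _ hK h => oneLinkPoincareSUN_twisted hN hK h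

/-- **T87b_SUNTwistedBeyondBakryEmery — EVERY `SU(N)`, `N ≥ 2`, HYPOTHESIS-FREE**: (i) the twisted constant is strictly larger than Bakry–Émery's at every
`0 ≤ R ≤ 1/2` (`bakryEmery_lt_twisted_sun`); (ii) at the Bakry–Émery cap `OneLinkPoincareSUN N (1/2) (8N/7)`; (iii) beyond it
`OneLinkPoincareSUN N (1/2 + 1/(2N²)) (8N/3)` (`TwistedBochnerEveryN`). -/
def T87b_SUNTwistedBeyondBakryEmery : Prop :=
  (∀ N : ℕ, 2 ≤ N → ∀ R : ℝ, 0 ≤ R → R ≤ 1 / 2 →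
    (N : ℝ) * (1 / 2 - R) <
      (N : ℝ) * ((N : ℝ) ^ 2 - 1) / (2 * ((N : ℝ) ^ 2 - 2)) - ((N : ℝ) ^ 2 - 1) / N * R - ((N : ℝ) ^ 2 - 1) / (2 * N * ((N : ℝ) ^ 2 - 2)) * R ^ 2) ∧
  (∀ N : ℕ, 2 ≤ N → OneLinkPoincareSUN N (1 / 2) (8 * N / 7)) ∧
  (∀ N : ℕ, 2 ≤ N → OneLinkPoincareSUN N (1 / 2 + 1 / (2 * (N : ℝ) ^ 2)) (8 * N / 3))

/-- T87b_SUNTwistedBeyondBakryEmery holds. -/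
theorem T87b_SUNTwistedBeyondBakryEmery_holds : T87b_SUNTwistedBeyondBakryEmery :=
  ⟨fun _ hN _ h0 h => bakryEmery_lt_twisted_sun hN h0 h, fun _ hN => oneLinkPoincareSUN_twisted_half hN,
    fun _ hN => oneLinkPoincareSUN_twisted_beyond_half hN⟩

/-- **T87c_SU4TwistedPoincareRows — `SU(4)`, HYPOTHESIS-FREE**: `OneLinkPoincareSUN 4 (3/10) 1 ∧ OneLinkPoincareSUN 4 (2/5) (50/31) ∧ OneLinkPoincareSUN 4 (1/2) (64/15)`
(Bakry–Émery: `5/4`, `5/2`, nothing). -/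
def T87c_SU4TwistedPoincareRows : Prop :=
  OneLinkPoincareSUN 4 (3 / 10) 1 ∧ OneLinkPoincareSUN 4 (2 / 5) (50 / 31) ∧ OneLinkPoincareSUN 4 (1 / 2) (64 / 15)

/-- T87c_SU4TwistedPoincareRows holds. -/
theorem T87c_SU4TwistedPoincareRows_holds : T87c_SU4TwistedPoincareRows :=
  ⟨oneLinkPoincareSUN_su4_twisted_threeTenths, oneLinkPoincareSUN_su4_twisted_twoFifths, oneLinkPoincareSUN_su4_twisted_half⟩

/-- **T87d_SU3TwistedPoincareTrace — `SU(3)`, HYPOTHESIS-FREE**: the trace-norm twisted one-link Poincaré constant: for every `0 < K` and `R` with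
`K + (64/35)R ≤ 12/7`, `OneLinkPoincareSUN 3 R (1/K)` (`TwistedBochner.oneLinkPoincareSUN_su3_twisted_tr`; T71a: `(97/50)R`; Bakry–Émery: `1/(3(1/2 − R))`). -/
def T87d_SU3TwistedPoincareTrace : Prop :=
  ∀ R K : ℝ, 0 < K → K + 64 / 35 * R ≤ 12 / 7 → OneLinkPoincareSUN 3 R (1 / K)

/-- T87d_SU3TwistedPoincareTrace holds. -/
theorem T87d_SU3TwistedPoincareTrace_holds : T87d_SU3TwistedPoincareTrace := fun _ _ hK h => oneLinkPoincareSUN_su3_twisted_tr hK h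

end Engine2EveryNsec



end V23I_engine2_EveryN

/-! ### OWNER FILE `owners/V1XConjunctsDS3g14E.lean` (sha16 e22e68fa09be3eb4) — section `V23I_ds3_KernelEnergyVariance` -/
section V23I_ds3_KernelEnergyVariance

/-!
Statement v1.x candidate conjuncts from ds-3's gen-14 files, PART E (TEXT for the p2/p3 seats; checkable once `KernelSusceptibility.lean` is IN
THE TREE; NOT proposed by ds-3). Y2 ROBUST-BALL, currency C-KMIX (V): the uniform finite-volume energy-variance ceiling. HONEST LABEL: lattice
strong-coupling statement inside the single-link door; «specific heat» = variance density; nothing continuum.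
-/

open MeasureTheory Filter Topology ProbabilityTheory
open scoped NNReal
open Literature.Probability.LatticeModels hiding configShift configShift_apply
open Literature.MathematicalPhysics.QuantumLattice (fundamentalRep ZdEdge LGConfig ymSpecification ZdPlaquette)
open Literature.MathematicalPhysics.QuantumFieldTheory (zdPlaquetteObs)
open Summit.Ventures.YMGap
open Summit.Ventures.YMGap.RobustBall

/-- **T88_SU2WilsonKernelEnergyVariance — `SU(2)` LATTICE YANG–MILLS ON `ℤ⁴`, `0 ≤ β_W ≤ 1/12`**: there is ONE `χ` such that for EVERY finite
link volume `Λ`, EVERY boundary field `η` and every finite set `P` of plaquettes: `Var_{γ_Λ(·|η)}(Σ_{p∈P} W_p) ≤ χ · #P`, `W_p = ½ Re tr U_p` —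
the finite-volume energy fluctuation per plaquette is bounded uniformly in the volume, the boundary field and the region
(`RobustBall.su2_wilson_kernel_energyVariance_upTo_oneTwelfth`). -/
def T88_SU2WilsonKernelEnergyVariance : Prop :=
  ∀ βW : ℝ, 0 ≤ βW → βW ≤ 1 / 12 →
    ∃ χ : ℝ, ∀ (Λ : Finset (ZdEdge 4)) (η : LGConfig 4 (Matrix.specialUnitaryGroup (Fin 2) ℂ)) (P : Finset (ZdPlaquette 4)),
      Var[fun U => ∑ p ∈ P, zdPlaquetteObs (fundamentalRep (Fin 2)) p.1 p.2.1.1 p.2.1.2 U;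
        ymSpecification (d := 4) (fundamentalRep (Fin 2)) (βW / 2) Λ η] ≤ χ * P.card

/-- T88_SU2WilsonKernelEnergyVariance holds. -/
theorem T88_SU2WilsonKernelEnergyVariance_holds : T88_SU2WilsonKernelEnergyVariance :=
  fun _ h0 h => su2_wilson_kernel_energyVariance_upTo_oneTwelfth h0 h

end V23I_ds3_KernelEnergyVariance

/-! ### OWNER FILE `owners/T-texts-engine2-PV2Tr.lean` (sha16 fad7f67898b66390) — section `V23I_engine2_PV2Tr` -/
section V23I_engine2_PV2Tr

/-!
# Venture statement — YMGap (cell `pub-ymgap`) — OWNER TEXT «engine-2 PV2Tr: the SU(3) area-law and string-tension SEGMENTS on the ball at the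
# trace-norm twisted one-link constant, hypothesis-free» for the lead's next V-block; engine-2 g15 (texts of the g12 files F5/F6).
# STAGED — p3 files it only after the parents `RobustBall/AreaLawRowsSU3PV2Tr` / `RobustBall/StringTensionOnBallSU3PV2Tr` are ACCEPTED + built.

HONEST FRAMING. WHAT THIS IS: kernel-checked strong-coupling LATTICE statements for `SU(3)` lattice Yang–Mills, HYPOTHESIS-FREE («no displayed one-link
hypothesis»: the one-link input is engine-2 g12's TRACE-NORM twisted Poincaré constant `OneLinkPoincareSUN 3 R (1/K_p)`, `K_p + (64/35)R ≤ 12/7`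
(`Thresholds/TwistedBochnerSU3Trace.lean`), combined with engine-2 g10's centred Schwinger–Dyson variance through pub-balaban's door `K = √(c·v)`
(`Thresholds/OneLinkModulusSU3TwistedTrace.lean`)): (i) the AREA-LAW SEGMENTS on ONE fixed gauge-invariant finite-range slab-local ball
`AreaLawOnBall 3 4 (β_W/3) (7/500) (7/1000) r mv` for EVERY `0 ≤ β_W ≤ 3/5` and `AreaLawOnBall 3 3 (β_W/3) (7/500) (7/1000) r mv` for EVERY `0 ≤ β_W ≤ 9/10`
(`RobustBallPV.su3_pv2trRow4_upTo_3_5`, `RobustBallPV.su3_pv2trRow3_upTo_9_10`; certificate at the fixed one-link radius `2/5`); (ii) the STRING-TENSION reading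
of the `d = 4` segment: for every `0 ≤ β_W ≤ 3/5` every limit state of a family eventually in `ClusterDomainFR (7/500) (7/1000) r ∩ IsSlabLocal mv` has
`HasAreaLawWith μ χ₃ C c` with one `(C, c)`, `c > 0`, per `(r, mv)`, and `σ ≥ c` whenever the string tension exists (`RobustBallPV.su3_stringTension_onBall_pv2tr_upTo_3_5`,
rb-p2's `suFundStringTension_ge_onBall`).  HONEST LABEL: thresholds / radii / loads are where the doors close (door artefacts), strong coupling only; supersedes
T71d (`AreaLawOnBall … (97/500) (97/1000)` up to `1/2`, `(13/100) (13/200)` up to `4/5`) and the PV2T string-tension segment `29/50` in REACH (`3/5`, `9/10`) on a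
SMALLER ball (`7/500`, `7/1000`) — not in kind; `σ`-existence for non-Wilson members NOT claimed.
NOT CLAIMED: anything for SU(2); anything for `N ≥ 4`; any change to the CERTIFIED (H1 ∧ H2) SU(3) column; sharpness; anything about the crossover, the
continuum, or the Clay problem.
-/



section Engine2PV2Trsec

open MeasureTheory Filter Topology
open Literature.MathematicalPhysics.QuantumLattice
open Literature.MathematicalPhysics.QuantumFieldTheory hiding ZdEdge Site
open Literature.Barriers.QuantumFields (suFundStringTension)
open Summit.Ventures.YMGap.RobustBall
open Summit.Ventures.YMGap.RobustBallPV

/-- **T89a_SU3AreaLawSegmentsPV2Tr — `SU(3)`, the PV2Tr AREA-LAW SEGMENTS on ONE tier-1 ball, HYPOTHESIS-FREE**: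
`∀ 0 ≤ β_W ≤ 3/5, ∀ r, ∀ mv ≥ 1, AreaLawOnBall 3 4 (β_W/3) (2·(7/1000)) (7/1000) r mv` (`RobustBallPV.su3_pv2trRow4_upTo_3_5`) and
`∀ 0 ≤ β_W ≤ 9/10, ∀ r, ∀ mv ≥ 1, AreaLawOnBall 3 3 (β_W/3) (2·(7/1000)) (7/1000) r mv` (`RobustBallPV.su3_pv2trRow3_upTo_9_10`). -/
def T89a_SU3AreaLawSegmentsPV2Tr : Prop :=
  (∀ βW : ℝ, 0 ≤ βW → βW ≤ 3 / 5 → ∀ r : ℕ, ∀ mv : ℕ, 1 ≤ mv → AreaLawOnBall 3 4 (βW / 3) (2 * (7 / 1000)) (7 / 1000) r mv) ∧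
  (∀ βW : ℝ, 0 ≤ βW → βW ≤ 9 / 10 → ∀ r : ℕ, ∀ mv : ℕ, 1 ≤ mv → AreaLawOnBall 3 3 (βW / 3) (2 * (7 / 1000)) (7 / 1000) r mv)

/-- T89a_SU3AreaLawSegmentsPV2Tr holds. -/
theorem T89a_SU3AreaLawSegmentsPV2Tr_holds : T89a_SU3AreaLawSegmentsPV2Tr :=
  ⟨fun _ h0 h r _ hmv => su3_pv2trRow4_upTo_3_5 h0 h r hmv, fun _ h0 h r _ hmv => su3_pv2trRow3_upTo_9_10 h0 h r hmv⟩

/-- **T89b_SU3StringTensionOnBallPV2Tr — `SU(3)`, `d = 4`, the STRING-TENSION reading of the whole segment `0 ≤ β_W ≤ 3/5` on ONE ball, HYPOTHESIS-FREE**: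
for every `0 ≤ β_W ≤ 3/5`, every range `r` and every `mv ≥ 1` there are `C` and `c > 0` such that every limit state `μ` of every perturbation family eventually
in `ClusterDomainFR (2·(7/1000)) (7/1000) r ∩ IsSlabLocal mv`, at coupling `β_W/3`, has `HasAreaLawWith μ χ₃ C c`, and `c ≤ σ(μ)` whenever the string tension exists
(`RobustBallPV.su3_stringTension_onBall_pv2tr_upTo_3_5`). -/
def T89b_SU3StringTensionOnBallPV2Tr : Prop :=
  ∀ βW : ℝ, 0 ≤ βW → βW ≤ 3 / 5 → ∀ r mv : ℕ, 1 ≤ mv → ∃ C c : ℝ, 0 < c ∧ ∀ 𝓦 : PerturbationFamily 4 3,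
    (∀ᶠ L : ℕ in atTop, 𝓦 L ∈ ClusterDomainFR (2 * (7 / 1000)) (7 / 1000) r ∧ IsSlabLocal mv (𝓦 L)) →
      ∀ μ ∈ perturbedLimitPoints (βW / 3) 𝓦,
        HasAreaLawWith μ (fun g => normalisedCharacter 3 (fundamentalRep (Fin 3) g)) C c ∧
        ((∃ σ : ℝ, HasStringTension μ (fun g => normalisedCharacter 3 (fundamentalRep (Fin 3) g)) σ) →
          c ≤ suFundStringTension 3 μ)

/-- T89b_SU3StringTensionOnBallPV2Tr holds. -/
theorem T89b_SU3StringTensionOnBallPV2Tr_holds : T89b_SU3StringTensionOnBallPV2Tr :=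
  fun _ h0 h r _ hmv => su3_stringTension_onBall_pv2tr_upTo_3_5 h0 h r hmv

end Engine2PV2Trsec



end V23I_engine2_PV2Tr

/-! ### OWNER FILE `owners/V1X-CONJUNCTS-ds1g14-B.lean` (sha16 1dbc3b83fcfcfda9) — section `V23I_ds1_OneStateSharp` -/
section V23I_ds1_OneStateSharp

/-!
# v1.x conjunct CANDIDATE texts for p3 (ds-1 g14, block B: ONE-STATE-G with the SHARP count) — NOT a proposal. Numbering is p3's.
# Parent: `Thresholds/StrongCouplingAllGroupsSharp` (p387021); green inside HOME/ds/ds1g14/lean/MonoVB.lean until its olean exists.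
HONEST FRAMING: strong-coupling LATTICE statements (Wilson action), arbitrary compact gauge group; DLR uniqueness on the total-variation
Dobrushin corner `6(d−1) C_ρ |β| < 1` (`U(1)` / `ℤ_n`, `d = 4`: `|β| < 1/18`; `SU(2)`, `d = 4`: `1/36` ≪ the tree's `9/50`). Nothing
continuum / Clay. All HYPOTHESIS-FREE.
-/


open MeasureTheory Set Filter Topology
open Literature.Probability.LatticeModels (HasUniqueGibbsMeasure)
open Literature.MathematicalPhysics.QuantumLattice
open Literature.MathematicalPhysics.QuantumFieldTheory hiding ZdEdge Site IsInfiniteVolumeLimit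


/-- ONE-STATE-G, sharp (unitary representations): for a continuous UNITARY representation `ρ : G → U(N)` of a compact metrisable
group, every `d` and `6(d−1) N |β| < 1`: EXACTLY ONE DLR state, which is translation invariant and is the limit of the FULL sequence of
torus Wilson states on bounded continuous observables. -/
def T90_UnitaryStrongCouplingCornerSharp : Prop :=
  ∀ (d N : ℕ) (G : Type) [Group G] [TopologicalSpace G] [IsTopologicalGroup G] [CompactSpace G] [MeasurableSpace G]
    [BorelSpace G] [SecondCountableTopology G] [T2Space G] (ρ : G →* Matrix (Fin N) (Fin N) ℂ), Continuous ρ →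
    (∀ g, ρ g ∈ Matrix.unitaryGroup (Fin N) ℂ) → ∀ β : ℝ, 6 * ((d - 1 : ℕ) : ℝ) * N * |β| < 1 →
      HasUniqueGibbsMeasure (ymSpecification (d := d) ρ β) ∧
      ∀ μ ∈ ymGibbsMeasures (d := d) ρ β, IsZdTranslationInvariant μ ∧
        ∀ (f : LGConfig d G → ℝ) (K : ℝ), Continuous f → (∀ U, |f U| ≤ K) →
          Tendsto (fun L : ℕ => ∫ U, f U ∂(torusState ρ β (L + 1))) atTop (𝓝 (∫ U, f U ∂μ))

/-- Proof of `T90_UnitaryStrongCouplingCornerSharp`. -/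
theorem T90_UnitaryStrongCouplingCornerSharp_holds : T90_UnitaryStrongCouplingCornerSharp :=
  fun _ N _ _ _ _ _ _ _ _ _ ρ hρ hρu _ hβ =>
    ⟨StrongCouplingAllGroupsSharp.hasUniqueGibbsMeasure_sharp_of_unitary ρ hρ hρu hβ, fun _ hμ =>
      ⟨StrongCouplingAllGroupsSharp.isZdTranslationInvariant_sharp ρ hρ (Nat.cast_nonneg N) (abs_plaquetteObs_le_holds ρ hρu)
          hβ hμ,
        fun _ _ hf hK => StrongCouplingAllGroupsSharp.tendsto_integral_torusState_sharp ρ hρ (Nat.cast_nonneg N)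
          (abs_plaquetteObs_le_holds ρ hρu) hβ hμ hf hK⟩⟩

section U1

variable [MeasurableSpace Circle] [BorelSpace Circle]

end U1



end V23I_ds1_OneStateSharp

/-! ### OWNER FILE `owners/V1XConjunctsDS3g17E.lean` (sha16 0eca03929cff5b53) — section `V23I_ds3_BoundaryFreeEnergyDim` -/
section V23I_ds3_BoundaryFreeEnergyDim

/-!
Statement v1.x candidate conjunct from ds-3's gen-17 files, PART E (TEXT for the p2/p3 seats; checkable once `RobustBall/BoundaryFreeEnergyDim.lean`
(p388898, ACCEPTED d0546ba3e3f0) has its olean BUILT; NOT proposed by ds-3). Y2 ROBUST-BALL / DS track, object «C-DS-I» for EVERY `N ≥ 2` and EVERY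
`d ≥ 2` (cells of rows 3b‴/T14B): boundary-uniform free-energy additivity of finite regions of `ℤ^d` with frozen boundary links, `SU(N)` Wilson,
HYPOTHESIS-FREE on the 't Hooft ρ-window `0 ≤ β < 1/(16(d−1))` (the ratio hypothesis is satisfiable iff `β < 1/(16(d−1))`; the typed bounds
`β ≤ 1/(12(d−1))`, `β < 1/(8d)` are ds-1's `C¹` window and the sharp one-state window — lead R347 (A)). HONEST LABEL: lattice strong coupling,
one-sided in `β`; constants are door artefacts; nothing continuum, nothing at the Y3 couplings, nothing Clay.
-/

open MeasureTheory Filter Topology ProbabilityTheory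
open scoped NNReal
open Literature.Probability.LatticeModels hiding configShift configShift_apply
open Literature.MathematicalPhysics.QuantumLattice (fundamentalRep ZdEdge ZdPlaquette LGConfig plaquettesTouching plaquetteEdges
  wilsonBoundaryAction freeEnergyDensity)
open Literature.MathematicalPhysics.QuantumFieldTheory (haarProbability)
open Summit.Ventures.YMGap
open Summit.Ventures.YMGap.RobustBall

/-- **T91_SUNBoundaryFreeEnergyDim — `SU(N)` LATTICE YANG–MILLS ON `ℤ^d`, EVERY `N ≥ 2`, EVERY `d ≥ 2`** ('t Hooft `0 ≤ β ≤ 1/(12(d−1))`, `β < 1/(8d)`,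
tree coupling `N β`, ratio `max(ρ,½)` for any `6(d−1)β/(½ − 2(d−1)β) ≤ ρ < 1` — non-vacuous exactly on `β < 1/(16(d−1))`): for every finite link
volume `Λ`, EVERY boundary field `η` and depths `D_p ≤ ‖y − z‖_∞` for all links `y` of `p ∈ T(Λ)` and `z ∉ Λ`,
`|log Z_Λ(Nβ|η) − (#T(Λ)/#planes(d))·f(Nβ)| ≤ N β · Σ_{p∈T(Λ)} min (2N) (32 N⁴ √N · max(ρ,½)^{⌊D_p⌋})`
(`BoundaryFreeEnergy.suN_abs_log_normaliser_sub_freeEnergy_le`). -/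
def T91_SUNBoundaryFreeEnergyDim : Prop :=
  ∀ (d N : ℕ), 2 ≤ d → 2 ≤ N → ∀ (β ρ : ℝ), 0 ≤ β → β ≤ 1 / (12 * ((d : ℝ) - 1)) → β < 1 / (8 * (d : ℝ)) →
    6 * ((d : ℝ) - 1) * β / (1 / 2 - β * (2 * ((d : ℝ) - 1))) ≤ ρ → ρ < 1 →
    ∀ (Λ : Finset (ZdEdge d)) (η : LGConfig d (Matrix.specialUnitaryGroup (Fin N) ℂ)) (D : ZdPlaquette d → ℝ),
      (∀ p ∈ plaquettesTouching Λ, ∀ y ∈ plaquetteEdges p, ∀ z, z ∉ Λ → D p ≤ ‖y.1 - z.1‖) →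
      |Real.log (∫ ζ, Real.exp (-(N * β) * wilsonBoundaryAction (fundamentalRep (Fin N)) Λ (glueWith Λ ζ η))
            ∂(Measure.pi fun _ : ↥Λ => haarProbability (Matrix.specialUnitaryGroup (Fin N) ℂ))) -
          (plaquettesTouching Λ).card / (Fintype.card {q : Fin d × Fin d // q.1 < q.2} : ℝ) *
            freeEnergyDensity d (fundamentalRep (Fin N)) (N * β)| ≤
        N * β * ∑ p ∈ plaquettesTouching Λ,
          min (2 * (N : ℝ)) (32 * (N : ℝ) ^ 4 * Real.sqrt N * (max ρ (1 / 2)) ^ ⌊D p⌋₊)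

/-- T91_SUNBoundaryFreeEnergyDim holds. -/
theorem T91_SUNBoundaryFreeEnergyDim_holds : T91_SUNBoundaryFreeEnergyDim := by
  intro d N hd hN β ρ hβ0 hβ hβ' hρ hρ1 Λ η D hD
  classical
  exact BoundaryFreeEnergy.suN_abs_log_normaliser_sub_freeEnergy_le hd hN hβ0 hβ hβ' hρ hρ1 Λ η D hD

end V23I_ds3_BoundaryFreeEnergyDim

/-! ### DEFAULT GROUPING (p2): one consolidating conjunction per owner file — `G_<tag> := T_a ∧ T_b ∧ …` + `_holds`.
The lead composes V23I by theme; p3 renames `G_<tag> ↦ T<k>_<Name>` (via --map) or regroups at will; these are additions, not owner bytes. -/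
section V23I_groups

/-- Default group for section `V23I_engine2_EveryN`: the conjunction of its 4 owner texts. -/
def T87_TwistedOneLinkPoincareEveryN : Prop :=
  T87a_SUNTwistedPoincare ∧ T87b_SUNTwistedBeyondBakryEmery ∧ T87c_SU4TwistedPoincareRows ∧ T87d_SU3TwistedPoincareTrace

/-- `T87_TwistedOneLinkPoincareEveryN` holds (componentwise by the owners' `_holds`). -/
theorem T87_TwistedOneLinkPoincareEveryN_holds : T87_TwistedOneLinkPoincareEveryN :=
  ⟨T87a_SUNTwistedPoincare_holds, T87b_SUNTwistedBeyondBakryEmery_holds, T87c_SU4TwistedPoincareRows_holds, T87d_SU3TwistedPoincareTrace_holds⟩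

/-- Default group for section `V23I_engine2_PV2Tr`: the conjunction of its 2 owner texts. -/
def T89_SU3BallAreaLawAndStringTensionPV2Tr : Prop :=
  T89a_SU3AreaLawSegmentsPV2Tr ∧ T89b_SU3StringTensionOnBallPV2Tr

/-- `T89_SU3BallAreaLawAndStringTensionPV2Tr` holds (componentwise by the owners' `_holds`). -/
theorem T89_SU3BallAreaLawAndStringTensionPV2Tr_holds : T89_SU3BallAreaLawAndStringTensionPV2Tr :=
  ⟨T89a_SU3AreaLawSegmentsPV2Tr_holds, T89b_SU3StringTensionOnBallPV2Tr_holds⟩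

end V23I_groups

end Summit.Ventures.YMGap

end
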